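import Summits.NavierStokesRegularity.FunctionalMining.NoGo.TopEigHeatVariance
import Summits.NavierStokesRegularity.FunctionalMining.NoGo.TopEigAmplitudeFloorLow
import HarnessLib

/-!
# (R12) RATE–VARIANCE / FLATTENING for every real `q > 1` (no-go seat, gen 53, touch 4)

Honest framing (page 1): **search for candidate a priori estimates; no regularity claim.** This
file decides NO node of the cell. It extends a typed DESIGN RULE for door D-K6 (b) = (F2)
(`¬ TopEigHeatCoercivePos (d := Fin 3) q`, OPEN in the kernel for every real `q > 1`) from the
range `q ≥ 2` to the whole range `q > 1`.

The tree (`NoGo/TopEigHeatVariance.lean`, rule (R12)) proves, for real `q ≥ 2` and smooth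
divergence-free `v` on `T³`,
`16π²(q−1)/q · ∫ (λ₁^{q/2} − ∫λ₁^{q/2})² ≤ heatDissipation Φ_q v`
(`Variance.rate_variance_le_heatDissipation`) from three inputs: the amplitude floor LEMMA AF
(`q ≥ 2` there), the a.e. identity `‖∇(λ₁^{q/2})‖² = (q²/4) λ₁^{q−2} Σᵢ(∂ᵢλ₁)²` and the Poincaré
inequality for LIPSCHITZ functions — and `λ₁^{q/2}` is Lipschitz only for `q ≥ 2`.

Below `q = 2` the power `λ₁^{q/2}` is merely Hölder at the zeros of `λ₁`, so we REGULARISE: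
`ζ_ε := (λ₁ + ε)^{q/2}` (`ε > 0`) IS Lipschitz (§ 1), the Lipschitz Poincaré inequality applies to
it, and at Rademacher points of `λ₁`
`‖∇ζ_ε‖² = (q²/4)(λ₁ + ε)^{q−2}‖∇λ₁‖² ≤ (q²/4) λ₁^{q−2} Σᵢ(∂ᵢλ₁)²` for `q ≤ 2`
(the exponent `q − 2 ≤ 0` makes the regularised weight SMALLER where `λ₁ > 0`; at the zeros
of `λ₁ ≥ 0` every junk-valued partial vanishes by Fermat,
`FloorLow.partialDeriv_eq_zero_of_globalMin`).
The right-hand side is the floor integrand, INTEGRABLE with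
`q(q−1)∫λ₁^{q−2}Σᵢ(∂ᵢλ₁)² ≤ heatDissipation Φ_q v` for every real `q > 1` by the Fatou form of
LEMMA AF (`NoGo/TopEigAmplitudeFloorLow.lean`, `topEigAmplitudeFloor_of_one_lt`). Hence
`4π² Var(ζ_ε) ≤ (q²/4)∫λ₁^{q−2}Σᵢ(∂ᵢλ₁)²` uniformly in `ε` (§ 2), and `Var(ζ_ε) → Var(λ₁^{q/2})` as
`ε = 1/(n+1) → 0` by dominated convergence (§ 3). Outputs (§ 4, `T³`):

* `VarianceLow.rate_variance_le_heatDissipation_of_one_lt (hq : 1 < q)` — the rate–variance rule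
  with the SAME constant `16π²(q−1)/q` on the whole range;
* `VarianceLow.rate_moments_le_heatDissipation_of_one_lt`,
  `VarianceLow.moments_deficit_le_of_one_lt`
  (`Φ_q − Φ_{q/2}² ≤ q/(16π²(q−1)) · heatDissipation Φ_q v`) and the ratio form
  `VarianceLow.moment_ratio_deficit_le_of_one_lt`
  (`1 − Φ_{q/2}²/Φ_q ≤ q/(16π²(q−1)) · heatDissipation Φ_q v / Φ_q`): along a killing family at ANY
  real exponent `q > 1` the moment ratio `Φ_{q/2}(v_n)²/Φ_q(v_n)` tends to `1` (FLATTENING).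

NOT CLAIMED: no node is decided; L-λ(q) (`TopEigHeatCoercivePos q`) stays OPEN in the kernel for
every real `q > 1`; nothing here is a coercivity or a killing statement; the no-concentration
family rules (R12′) are not touched. Door (b) on paper: CLOSED NEGATIVELY for every real `q > 1`
(cell record); kernel: OPEN.

search for candidate a priori estimates; no regularity claim
FILING (prove seat g30, REQUEST #87): declarations byte-identical to the no-go seat's staged `TopEigHeatVarianceLow.STAGING.lean` fceb86dd08d3b36a; this line is the only addition.
-/

noncomputable section

open MeasureTheory Set Filter Topology Metric Function
open scoped NNReal ENNReal

namespace Summit.NavierStokesRegularity.FunctionalMining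

open Literature.Analysis.FunctionSpaces Literature.Analysis.FunctionSpaces.Torus

variable {d : Type*} [Fintype d] [DecidableEq d]

namespace TopEig

namespace VarianceLow

/-! ## § 1 The regularised power `(λ₁ + ε)^p` (any `d`) -/

section Regularised

variable [Nonempty d] {v : UnitAddTorus d → EuclideanSpace ℝ d}

/-- `(λ₁ + ε)^p` is Lipschitz for EVERY real `p > 0` and `ε > 0` (`λ₁` is Lipschitz with values in
`[0, M]`, and `t ↦ (t + ε)^p` is `C¹` on `[0, M + 1]`). [folklore] -/
theorem exists_lipschitzWith_rpow_topEig_add (hv : Torus.IsSmooth v) (hdv : Torus.IsDivFree v)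
    {p ε : ℝ} (hp : 0 < p) (hε : 0 < ε) :
    ∃ C : ℝ≥0, LipschitzWith C (fun y => (torusStrainTopEig v y + ε) ^ p) := by
  obtain ⟨K, hK⟩ := exists_lipschitzWith_torusStrainTopEig hv
  obtain ⟨M, hM⟩ := Torus.exists_forall_norm_le_of_continuous (continuous_torusStrainTopEig hv)
  have hLnn : ∀ x, 0 ≤ torusStrainTopEig v x := fun x => by
    rw [← lam_strainFlat]; exact lam_strainFlat_nonneg hv hdv x
  have hLM : ∀ x, torusStrainTopEig v x ≤ M := fun x =>
    (le_abs_self _).trans (Real.norm_eq_abs _ ▸ hM x)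
  have hM0 : 0 ≤ M := (hLnn 0).trans (hLM 0)
  set L : ℝ := p * (ε ^ (p - 1) + (M + 1 + ε) ^ (p - 1)) with hL
  have hL0 : 0 ≤ L := mul_nonneg hp.le
    (add_nonneg (Real.rpow_nonneg hε.le _) (Real.rpow_nonneg (by linarith) _))
  have hpow : LipschitzOnWith (Real.toNNReal L) (fun t : ℝ => (t + ε) ^ p) (Icc 0 (M + 1)) := by
    refine (convex_Icc 0 (M + 1)).lipschitzOnWith_of_nnnorm_hasDerivWithin_le
      (f' := fun t => 1 * p * (t + ε) ^ (p - 1))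
      (fun t ht => (((hasDerivAt_id' t).add_const ε).rpow_const
        (Or.inl (by linarith [ht.1] : 0 < t + ε).ne')).hasDerivWithinAt) fun t ht => ?_
    rw [← NNReal.coe_le_coe, coe_nnnorm, Real.coe_toNNReal _ hL0, Real.norm_eq_abs, one_mul,
      abs_of_nonneg (mul_nonneg hp.le (Real.rpow_nonneg (by linarith [ht.1]) _)), hL]
    refine mul_le_mul_of_nonneg_left ?_ hp.le
    rcases le_total (p - 1) 0 with h1 | h1
    · exact (Real.rpow_le_rpow_of_nonpos hε (by linarith [ht.1]) h1).trans
        (le_add_of_nonneg_right (Real.rpow_nonneg (by linarith) _))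
    · exact (Real.rpow_le_rpow (by linarith [ht.1]) (by linarith [ht.2]) h1).trans
        (le_add_of_nonneg_left (Real.rpow_nonneg hε.le _))
  refine ⟨Real.toNNReal L * K, ?_⟩
  have hmaps : MapsTo (torusStrainTopEig v) univ (Icc 0 (M + 1)) :=
    fun x _ => ⟨hLnn x, (hLM x).trans (by linarith)⟩
  exact lipschitzOnWith_univ.1 (hpow.comp hK.lipschitzOnWith hmaps)

/-- **A.e. chain rule for the regularised power**: `∇(λ₁ + ε)^p = p(λ₁ + ε)^{p−1}∇λ₁` at
Rademacher points of `λ₁`, for EVERY real `p` (the base `λ₁ + ε ≥ ε` is non-zero). [folklore] -/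
theorem gradient_rpow_topEig_add_eq_ae (hv : Torus.IsSmooth v) (hdv : Torus.IsDivFree v)
    (p : ℝ) {ε : ℝ} (hε : 0 < ε) :
    ∀ᵐ x ∂(volume : Measure (UnitAddTorus d)),
      Torus.gradient (fun y => (torusStrainTopEig v y + ε) ^ p) x =
        (p * (torusStrainTopEig v x + ε) ^ (p - 1)) •
          Torus.gradient (torusStrainTopEig v) x := by
  obtain ⟨K, hK⟩ := exists_lipschitzWith_torusStrainTopEig hv
  have hLnn : ∀ x, 0 ≤ torusStrainTopEig v x := fun x => by
    rw [← lam_strainFlat]; exact lam_strainFlat_nonneg hv hdv x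
  filter_upwards [Torus.ae_differentiableAt_liftAt hK] with x hx
  have hne : Torus.liftAt (torusStrainTopEig v) x 0 + ε ≠ 0 := by
    rw [Torus.liftAt_apply_zero]; exact (add_pos_of_nonneg_of_pos (hLnn x) hε).ne'
  have h3 := (Real.hasDerivAt_rpow_const (p := p) (Or.inl hne)).comp_hasFDerivAt
    (0 : EuclideanSpace ℝ d) ((Torus.hasFDerivAt_liftAt hx).add_const ε)
  rw [Torus.liftAt_apply_zero] at h3
  have h4 : Torus.fderiv (fun y => (torusStrainTopEig v y + ε) ^ p) x =
      (p * (torusStrainTopEig v x + ε) ^ (p - 1)) • Torus.fderiv (torusStrainTopEig v) x :=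
    h3.fderiv
  rw [Torus.gradient_eq_toDual_symm_torusFderiv, Torus.gradient_eq_toDual_symm_torusFderiv, h4,
    map_smul]

/-- **The regularised weight is dominated by the floor integrand (`q ≤ 2`).** A.e. on `T^d`:
`‖∇(λ₁ + ε)^{q/2}‖² ≤ (q²/4) λ₁^{q−2} Σᵢ(∂ᵢλ₁)²` — at Rademacher points with `λ₁ > 0` because
`(λ₁ + ε)^{q−2} ≤ λ₁^{q−2}` (`q − 2 ≤ 0`), at the zeros of `λ₁ ≥ 0` because every junk-valued
partial vanishes there (Fermat, `FloorLow.partialDeriv_eq_zero_of_globalMin`). [ours] -/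
theorem norm_sq_gradient_rpow_topEig_add_le_ae {q : ℝ} (hq : q ≤ 2) (hv : Torus.IsSmooth v)
    (hdv : Torus.IsDivFree v) {ε : ℝ} (hε : 0 < ε) :
    ∀ᵐ x ∂(volume : Measure (UnitAddTorus d)),
      ‖Torus.gradient (fun y => (torusStrainTopEig v y + ε) ^ (q / 2)) x‖ ^ 2 ≤
        q ^ 2 / 4 * (torusStrainTopEig v x ^ (q - 2) *
          ∑ i, (Torus.partialDeriv i (torusStrainTopEig v) x) ^ 2) := by
  have hLnn : ∀ x, 0 ≤ torusStrainTopEig v x := fun x => by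
    rw [← lam_strainFlat]; exact lam_strainFlat_nonneg hv hdv x
  filter_upwards [gradient_rpow_topEig_add_eq_ae hv hdv (q / 2) hε,
    Variance.norm_sq_gradient_topEig_eq_ae hv] with x hx hx'
  have hS : 0 ≤ ∑ i, (Torus.partialDeriv i (torusStrainTopEig v) x) ^ 2 :=
    Finset.sum_nonneg fun i _ => sq_nonneg _
  have hxe : 0 ≤ torusStrainTopEig v x + ε := by linarith [hLnn x]
  rw [hx, norm_smul, mul_pow, hx', Real.norm_eq_abs, sq_abs, mul_pow,
    ← Real.rpow_natCast ((torusStrainTopEig v x + ε) ^ (q / 2 - 1)) 2, ← Real.rpow_mul hxe]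
  have e : (q / 2 - 1) * ((2 : ℕ) : ℝ) = q - 2 := by push_cast; ring
  rw [e]
  have key : (torusStrainTopEig v x + ε) ^ (q - 2) *
      ∑ i, (Torus.partialDeriv i (torusStrainTopEig v) x) ^ 2 ≤
      torusStrainTopEig v x ^ (q - 2) *
        ∑ i, (Torus.partialDeriv i (torusStrainTopEig v) x) ^ 2 := by
    rcases (hLnn x).eq_or_lt with h0 | hpos
    · -- a zero of `λ₁ ≥ 0` is a global minimum: every partial vanishes, both sides are `0`
      have hz : ∀ i, Torus.partialDeriv i (torusStrainTopEig v) x = 0 := fun i =>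
        FloorLow.partialDeriv_eq_zero_of_globalMin (fun z => by rw [← h0]; exact hLnn z) i
      have hS0 : ∑ i, (Torus.partialDeriv i (torusStrainTopEig v) x) ^ 2 = 0 :=
        Finset.sum_eq_zero fun i _ => by rw [hz i, sq, mul_zero]
      rw [hS0, mul_zero, mul_zero]
    · exact mul_le_mul_of_nonneg_right
        (Real.rpow_le_rpow_of_nonpos hpos (le_add_of_nonneg_right hε.le) (by linarith)) hS
  calc (q / 2) ^ 2 * (torusStrainTopEig v x + ε) ^ (q - 2) *
        ∑ i, (Torus.partialDeriv i (torusStrainTopEig v) x) ^ 2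
      = q ^ 2 / 4 * ((torusStrainTopEig v x + ε) ^ (q - 2) *
          ∑ i, (Torus.partialDeriv i (torusStrainTopEig v) x) ^ 2) := by ring
    _ ≤ q ^ 2 / 4 * (torusStrainTopEig v x ^ (q - 2) *
          ∑ i, (Torus.partialDeriv i (torusStrainTopEig v) x) ^ 2) :=
        mul_le_mul_of_nonneg_left key (by positivity)

/-- **The regularised variances converge** (`p > 0`): as `ε = 1/(n+1) → 0`,
`∫ ((λ₁ + ε)^p − ∫(λ₁ + ε)^p)² → ∫ (λ₁^p − ∫λ₁^p)²` — dominated convergence twice (means, then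
variance integrands), everything bounded by powers of `M + 1` on the probability space `T^d`.
[folklore, bookkeeping] -/
theorem tendsto_variance_rpow_topEig_add (hv : Torus.IsSmooth v) (hdv : Torus.IsDivFree v)
    {p : ℝ} (hp : 0 < p) :
    Tendsto (fun n : ℕ => ∫ x, ((torusStrainTopEig v x + 1 / ((n : ℝ) + 1)) ^ p -
        ∫ y, (torusStrainTopEig v y + 1 / ((n : ℝ) + 1)) ^ p) ^ 2) atTop
      (𝓝 (∫ x, (torusStrainTopEig v x ^ p - ∫ y, torusStrainTopEig v y ^ p) ^ 2)) := by
  set L := torusStrainTopEig v with hL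
  have hLc : Continuous L := continuous_torusStrainTopEig hv
  have hLnn : ∀ x, 0 ≤ L x := fun x => by
    rw [hL, ← lam_strainFlat]; exact lam_strainFlat_nonneg hv hdv x
  obtain ⟨M, hM⟩ := Torus.exists_forall_norm_le_of_continuous hLc
  have hLM : ∀ x, L x ≤ M := fun x => (le_abs_self _).trans (Real.norm_eq_abs _ ▸ hM x)
  set e : ℕ → ℝ := fun n => 1 / ((n : ℝ) + 1) with he
  have he0 : ∀ n, 0 < e n := fun n => by rw [he]; positivity
  have he1 : ∀ n, e n ≤ 1 := fun n => by
    rw [he, div_le_one (by positivity)]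
    linarith [(n.cast_nonneg : (0 : ℝ) ≤ n)]
  have hte : Tendsto e atTop (𝓝 0) := tendsto_one_div_add_atTop_nhds_zero_nat
  set B : ℝ := (M + 1) ^ p with hB
  have hFc : ∀ n, Continuous fun x => (L x + e n) ^ p := fun n =>
    (hLc.add continuous_const).rpow_const fun x => Or.inr hp.le
  have hFb : ∀ n x, 0 ≤ (L x + e n) ^ p ∧ (L x + e n) ^ p ≤ B := fun n x =>
    ⟨Real.rpow_nonneg (by linarith [hLnn x, he0 n]) _,
      Real.rpow_le_rpow (by linarith [hLnn x, he0 n]) (by linarith [hLM x, he1 n]) hp.le⟩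
  have hFt : ∀ x, Tendsto (fun n => (L x + e n) ^ p) atTop (𝓝 (L x ^ p)) := fun x => by
    rw [show L x ^ p = (L x + 0) ^ p by rw [add_zero]]
    exact ((Real.continuous_rpow_const hp.le).tendsto _).comp (tendsto_const_nhds.add hte)
  -- the means converge and are bounded by `B`
  set c : ℕ → ℝ := fun n => ∫ y, (L y + e n) ^ p with hc
  have hct : Tendsto c atTop (𝓝 (∫ y, L y ^ p)) := by
    refine tendsto_integral_of_dominated_convergence (fun _ => B)
      (fun n => (hFc n).aestronglyMeasurable) (integrable_const B)
      (fun n => Eventually.of_forall fun x => ?_) (Eventually.of_forall hFt)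
    rw [Real.norm_eq_abs, abs_of_nonneg (hFb n x).1]; exact (hFb n x).2
  have hcb : ∀ n, |c n| ≤ B := fun n => by
    refine (abs_integral_le_integral_abs).trans ?_
    have h2 : ∫ y, |(L y + e n) ^ p| ≤ ∫ _y : UnitAddTorus d, B :=
      integral_mono (hFc n).abs.integrable_unitAddTorus (integrable_const B) fun y => by
        show |(L y + e n) ^ p| ≤ B
        rw [abs_of_nonneg (hFb n y).1]; exact (hFb n y).2
    simpa [integral_const, probReal_univ] using h2
  -- dominated convergence for the variance integrands
  refine tendsto_integral_of_dominated_convergence (fun _ => (B + B) ^ 2)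
    (fun n => (((hFc n).sub continuous_const).pow 2).aestronglyMeasurable) (integrable_const _)
    (fun n => Eventually.of_forall fun x => ?_)
    (Eventually.of_forall fun x => ((hFt x).sub hct).pow 2)
  rw [Real.norm_eq_abs, abs_pow]
  refine pow_le_pow_left₀ (abs_nonneg _) ((abs_sub _ _).trans (add_le_add ?_ (hcb n))) 2
  rw [abs_of_nonneg (hFb n x).1]; exact (hFb n x).2

end Regularised

/-! ## § 2–§ 4 The rate–variance rule on `T³` for every real `q > 1` -/

section FinThree

variable {v : UnitAddTorus (Fin 3) → EuclideanSpace ℝ (Fin 3)} {q : ℝ}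

/-- **§ 2 Uniform Poincaré bound for the regularised powers (`1 < q ≤ 2`, every `ε > 0`).**
`4π² ∫ ((λ₁ + ε)^{q/2} − ∫(λ₁ + ε)^{q/2})² ≤ (q²/4) ∫ λ₁^{q−2} Σᵢ(∂ᵢλ₁)²` — the Lipschitz
Poincaré inequality of the tree for `(λ₁ + ε)^{q/2}` (§ 1), the a.e. domination of § 1, and the
INTEGRABILITY of the floor integrand (Fatou form of LEMMA AF, `q > 1`). [ours] -/
theorem four_pi_sq_mul_variance_rpow_add_le (hq1 : 1 < q) (hq2 : q ≤ 2) (hv : Torus.IsSmooth v)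
    (hdv : Torus.IsDivFree v) {ε : ℝ} (hε : 0 < ε) :
    4 * Real.pi ^ 2 * ∫ x, ((torusStrainTopEig v x + ε) ^ (q / 2) -
        ∫ y, (torusStrainTopEig v y + ε) ^ (q / 2)) ^ 2 ≤
      q ^ 2 / 4 * ∫ x, torusStrainTopEig v x ^ (q - 2) *
        ∑ i, (Torus.partialDeriv i (torusStrainTopEig v) x) ^ 2 := by
  obtain ⟨C, hC⟩ := exists_lipschitzWith_rpow_topEig_add hv hdv (p := q / 2) (by linarith) hε
  refine (Variance.four_pi_sq_mul_integral_sq_sub_mean_le_of_lipschitz hC).trans ?_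
  rw [← integral_const_mul]
  refine integral_mono_of_nonneg (Eventually.of_forall fun x => sq_nonneg _) ?_
    (norm_sq_gradient_rpow_topEig_add_le_ae hq2 hv hdv hε)
  have hqq : q * (q - 1) ≠ 0 := mul_ne_zero (by linarith) (by linarith)
  refine ((FloorLow.integrable_floorIntegrand_and_integral_le hq1 hv hdv).1.const_mul
    ((q * (q - 1))⁻¹ * (q ^ 2 / 4))).congr (Eventually.of_forall fun x => ?_)
  show (q * (q - 1))⁻¹ * (q ^ 2 / 4) * (q * (q - 1) * _) = q ^ 2 / 4 * _
  rw [mul_mul_mul_comm, inv_mul_cancel₀ hqq, one_mul]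

/-- **§ 4 RATE–VARIANCE RULE below `q = 2`.** For `1 < q ≤ 2` and every smooth divergence-free
`v` on `T³`: `16π²(q−1)/q · ∫ (λ₁^{q/2} − ∫λ₁^{q/2})² ≤ heatDissipation Φ_q v` — § 2 along
`ε = 1/(n+1)`, the limit § 1 (`tendsto_variance_rpow_topEig_add`), and LEMMA AF for `q > 1`
(`topEigAmplitudeFloor_of_one_lt`). [ours] -/
theorem rate_variance_le_heatDissipation_of_le_two (hq1 : 1 < q) (hq2 : q ≤ 2)
    (hv : Torus.IsSmooth v) (hdv : Torus.IsDivFree v) :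
    16 * Real.pi ^ 2 * (q - 1) / q *
        ∫ x, (torusStrainTopEig v x ^ (q / 2) - ∫ y, torusStrainTopEig v y ^ (q / 2)) ^ 2 ≤
      heatDissipation (torusTopEigMoment q) v := by
  set A : ℝ := ∫ x, torusStrainTopEig v x ^ (q - 2) *
    ∑ i, (Torus.partialDeriv i (torusStrainTopEig v) x) ^ 2 with hA
  set V : ℝ := ∫ x, (torusStrainTopEig v x ^ (q / 2) -
    ∫ y, torusStrainTopEig v y ^ (q / 2)) ^ 2 with hV
  have hF : q * (q - 1) * A ≤ heatDissipation (torusTopEigMoment q) v :=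
    topEigAmplitudeFloor_of_one_lt (d := Fin 3) hq1 (Fintype.card_fin 3) v hv hdv
  have hPV : 4 * Real.pi ^ 2 * V ≤ q ^ 2 / 4 * A :=
    le_of_tendsto' ((tendsto_variance_rpow_topEig_add hv hdv (p := q / 2)
      (by linarith)).const_mul (4 * Real.pi ^ 2))
      fun n => four_pi_sq_mul_variance_rpow_add_le hq1 hq2 hv hdv (by positivity)
  have hq0 : q ≠ 0 := (by linarith : (0 : ℝ) < q).ne'
  calc 16 * Real.pi ^ 2 * (q - 1) / q * V
      = 4 * (q - 1) / q * (4 * Real.pi ^ 2 * V) := by ring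
    _ ≤ 4 * (q - 1) / q * (q ^ 2 / 4 * A) :=
        mul_le_mul_of_nonneg_left hPV (div_nonneg (by linarith) (by linarith))
    _ = q * (q - 1) * A := by field_simp
    _ ≤ heatDissipation (torusTopEigMoment q) v := hF

/-- **RATE–VARIANCE RULE for EVERY real `q > 1`** (variance form, same constant as the tree):
`16π²(q−1)/q · ∫ (λ₁^{q/2} − ∫λ₁^{q/2})² ≤ heatDissipation Φ_q v` — below `2` by regularisation
(this file), from `2` on by the tree (`Variance.rate_variance_le_heatDissipation`). [ours] -/
theorem rate_variance_le_heatDissipation_of_one_lt (hq : 1 < q) (hv : Torus.IsSmooth v)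
    (hdv : Torus.IsDivFree v) :
    16 * Real.pi ^ 2 * (q - 1) / q *
        ∫ x, (torusStrainTopEig v x ^ (q / 2) - ∫ y, torusStrainTopEig v y ^ (q / 2)) ^ 2 ≤
      heatDissipation (torusTopEigMoment q) v := by
  rcases le_total q 2 with h2 | h2
  · exact rate_variance_le_heatDissipation_of_le_two hq h2 hv hdv
  · exact Variance.rate_variance_le_heatDissipation h2 hv hdv

/-- **RATE–VARIANCE RULE for every real `q > 1` (moment form):**
`16π²(q−1)/q · (Φ_q(v) − Φ_{q/2}(v)²) ≤ heatDissipation Φ_q v`. [ours] -/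
theorem rate_moments_le_heatDissipation_of_one_lt (hq : 1 < q) (hv : Torus.IsSmooth v)
    (hdv : Torus.IsDivFree v) :
    16 * Real.pi ^ 2 * (q - 1) / q * (torusTopEigMoment q v - torusTopEigMoment (q / 2) v ^ 2) ≤
      heatDissipation (torusTopEigMoment q) v := by
  rw [← Variance.integral_sq_sub_mean_rpow_topEig_eq (by linarith) hv hdv]
  exact rate_variance_le_heatDissipation_of_one_lt hq hv hdv

/-- **(R12) FLATTENING for every real `q > 1`.** The moment deficit is paid for in heat:
`Φ_q(v) − Φ_{q/2}(v)² ≤ q/(16π²(q−1)) · heatDissipation Φ_q v`. [ours] -/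
theorem moments_deficit_le_of_one_lt (hq : 1 < q) (hv : Torus.IsSmooth v)
    (hdv : Torus.IsDivFree v) :
    torusTopEigMoment q v - torusTopEigMoment (q / 2) v ^ 2 ≤
      q / (16 * Real.pi ^ 2 * (q - 1)) * heatDissipation (torusTopEigMoment q) v := by
  have h := rate_moments_le_heatDissipation_of_one_lt hq hv hdv
  have hq0 : 0 < q := by linarith
  have hq1 : 0 < q - 1 := by linarith
  have hc : 0 < 16 * Real.pi ^ 2 * (q - 1) / q := by positivity
  refine ((le_div_iff₀' hc).2 h).trans_eq ?_
  rw [div_div_eq_mul_div]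
  ring

/-- **(R12) FLATTENING, ratio form, every real `q > 1`.** If `Φ_q(v) > 0` then
`1 − Φ_{q/2}(v)²/Φ_q(v) ≤ q/(16π²(q−1)) · heatDissipation Φ_q v / Φ_q(v)`: along a killing family
(`heatDissipation Φ_q v_n = o(Φ_q v_n)`) at ANY real exponent `q > 1` the moment ratio
`Φ_{q/2}(v_n)²/Φ_q(v_n)` tends to `1`. [ours] -/
theorem moment_ratio_deficit_le_of_one_lt (hq : 1 < q) (hv : Torus.IsSmooth v)
    (hdv : Torus.IsDivFree v) (hΦ : 0 < torusTopEigMoment q v) :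
    1 - torusTopEigMoment (q / 2) v ^ 2 / torusTopEigMoment q v ≤
      q / (16 * Real.pi ^ 2 * (q - 1)) *
        (heatDissipation (torusTopEigMoment q) v / torusTopEigMoment q v) := by
  rw [one_sub_div hΦ.ne', div_le_iff₀ hΦ, mul_assoc, div_mul_cancel₀ _ hΦ.ne']
  exact moments_deficit_le_of_one_lt hq hv hdv

end FinThree

end VarianceLow

end TopEig

end Summit.NavierStokesRegularity.FunctionalMining
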